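import Summits.PneNP.PneNP.Theorems.ExpanderLinearGeneratorsColumnTwoFinal
import Summits.PneNP.PneNP.Theses.ExpanderLinearGenerators

/-!
# PneNP / ExpanderLinearGenerators — `LinearGeneratorDepthFregeHard` is equivalent to its
column-weight-`≥ 3` case

Route `PneNP/ExpanderLinearGenerators`, crux stmt-PneNP-11443
(`Summit.PneNP.PneNP.Theses.ExpanderLinearGenerators.LinearGeneratorDepthFregeHard`, Krajíček's
Problem 19.4.5 in universal-expander form). The column-weight-`≤ 2` slice of the crux is a theorem
of the tree (`ColumnTwo.linearGeneratorDepthFregeHard_of_colWeight_le_two`, unconditional). Hence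
the crux is EQUIVALENT to its restriction to systems in which some variable occurs in at least
three equations — the hypergraph case, which contains bounded-depth Frege lower bounds for
expanding (e.g. random) `ℓ`-CNFs and is open in print. This file records that equivalence, so that
the open core of the item is a single displayed statement.

* `linearGeneratorDepthFregeHard_iff_three_le_colWeight` — the equivalence.

References: J. Krajíček, *Proof complexity* (CUP 2019), Problem 19.4.5; S. Gryaznov,
N. Talebanfard, *Bounded-depth Frege lower bounds for random 3-CNFs via deterministic
restrictions* (2024), abstract (the random-CNF case is "a major open problem").
-/

namespace Summit.PneNP.PneNP.Theorems

open Literature.Computability.MetaComplexity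
open Literature.Computability.Complexity (PropForm)

/-- **The crux is its column-weight-`≥ 3` case.** `LinearGeneratorDepthFregeHard` holds iff it
holds for the systems `E` in which some variable lies in the support of at least three equations:
the complementary case (every variable in at most two equations) is the unconditional theorem
`ColumnTwo.linearGeneratorDepthFregeHard_of_colWeight_le_two`; the two exponents are combined by
`min` (for `n ≥ 1`, `2^(n^(min ε₁ ε₂)) ≤ 2^(n^εᵢ)`). [Krajíček 2019, Problem 19.4.5; the
column-weight-two slice by routing (Urquhart–Fu 1996, Ben-Sasson 2002)] -/
theorem linearGeneratorDepthFregeHard_iff_three_le_colWeight :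
    Summit.PneNP.PneNP.Theses.ExpanderLinearGenerators.LinearGeneratorDepthFregeHard ↔
    ∀ (ℓ d : ℕ) (δ : ℝ), 1 ≤ ℓ → 0 < δ → δ < 1 → ∃ ε : ℝ, 0 < ε ∧ ∃ N : ℕ, ∀ n : ℕ, N ≤ n →
      ∀ (m : ℕ) (E : Fin m → LinEqMod 2 n),
      (∃ j : Fin n, 3 ≤ (Finset.univ.filter fun i => j ∈ (E i).supp).card) →
      (∀ i, (E i).supp.card ≤ ℓ) →
      IsBoundaryExpander (fun i => (E i).supp.map Fin.valEmbedding) ((n : ℝ) ^ (1 - δ)) (3 / 4 * ℓ) →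
      ¬ SystemSat E Finset.univ →
      ∀ π : List (PropForm ℕ),
        textbookFrege.IsDepthProofOf d π (PropForm.neg (PropForm.ofCNF (sumEncoding 1 E))) →
          (2 : ℝ) ^ ((n : ℝ) ^ ε) ≤ (proofSize π : ℝ) := by
  unfold Summit.PneNP.PneNP.Theses.ExpanderLinearGenerators.LinearGeneratorDepthFregeHard
  constructor
  · intro h ℓ d δ hℓ hδ hδ1
    obtain ⟨ε, hε, N, hN⟩ := h ℓ d δ hℓ hδ hδ1
    exact ⟨ε, hε, N, fun n hn m E _ hsparse hexp hunsat π hπ => hN n hn m E hsparse hexp hunsat π hπ⟩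
  · intro h ℓ d δ hℓ hδ hδ1
    obtain ⟨ε₁, hε₁, N₁, hN₁⟩ :=
      ColumnTwo.linearGeneratorDepthFregeHard_of_colWeight_le_two ℓ d δ hℓ hδ hδ1
    obtain ⟨ε₂, hε₂, N₂, hN₂⟩ := h ℓ d δ hℓ hδ hδ1
    refine ⟨min ε₁ ε₂, lt_min hε₁ hε₂, max (max N₁ N₂) 1, ?_⟩
    intro n hn m E hsparse hexp hunsat π hπ
    have hn1 : (1 : ℝ) ≤ n := by exact_mod_cast le_trans (le_max_right _ _) hn
    have hmono : ∀ {ε : ℝ}, min ε₁ ε₂ ≤ ε →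
        (2 : ℝ) ^ ((n : ℝ) ^ min ε₁ ε₂) ≤ (2 : ℝ) ^ ((n : ℝ) ^ ε) := fun hle =>
      Real.rpow_le_rpow_of_exponent_le one_le_two (Real.rpow_le_rpow_of_exponent_le hn1 hle)
    by_cases hcol : ∀ j : Fin n, (Finset.univ.filter fun i => j ∈ (E i).supp).card ≤ 2
    · exact (hmono (min_le_left _ _)).trans
        (hN₁ n (le_trans (le_trans (le_max_left _ _) (le_max_left _ _)) hn) m E hcol hsparse hexp
          hunsat π hπ)
    · push Not at hcol
      obtain ⟨j, hj⟩ := hcol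
      exact (hmono (min_le_right _ _)).trans
        (hN₂ n (le_trans (le_trans (le_max_right _ _) (le_max_left _ _)) hn) m E ⟨j, hj⟩ hsparse
          hexp hunsat π hπ)

end Summit.PneNP.PneNP.Theorems
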